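/-
Width seat `ym-line-cbag-p1-w3` (prover-ym-line-cbag-p1-w3-g8-0; own items stmt-QuantumFields-22254 / 22893 CLOSED proved), helping LINE 3
`route-QuantumFields-SixPlaneColdBox` (crux stmt-QuantumFields-25709 `DensityTransferG`): the torus MEAN of a plaquette cost read through the
box kernel at the two sites of the transfer (the single-observable companion of p1's pair identity `latticeConnectedCorr_pair_eq_boxKernelG`).
-/
import Summits.QuantumFields.YangMills.Theorems.SixPlaneColdBoxDlrPairsG

/-!
# Route `SixPlaneColdBox`, crux `DensityTransferG`: the torus plaquette mean through the box kernels (every plane, both sites)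

The datum floor of the six-plane transfer (`sixPlane_goodDatum_hlow`: the kernel-mean excesses `M_q(ω) = β·E_ω c_{(c_H;q)} − β·E_1 c_{(c_H;q)}
+ 2β^{−1/4}` and `M'_{q'}` at `c_H + Te₀`) is integrated over the torus Wilson state by the DLR equations: the torus expectation of the
box-kernel mean of `c_{(c_H;q)}` (resp. `c_{(c_H+Te₀;q')}`) at the periodic lift IS the torus expectation of the origin plaquette cost
`plaqCost0 ρ q` (resp. `q'`), by translation invariance — the quantity crux `TorusMeanNearColdBoxG` controls.  The two identities are the
`e2`/`e3` steps inside p1's `latticeConnectedCorr_pair_eq_boxKernelG`; this file records them as statements: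

* `torusMean_eq_kernelMean_pairG` — for `L+1 > 2(2H+T+2)`, every compact `G`, continuous unitary `ρ`, planes `q, q'`:
  `∫ plaqCost0 ρ q ∘ torusLift = ∫ K[c_{(c_H;q)}]` and `∫ plaqCost0 ρ q' ∘ torusLift = ∫ K[c_{(c_H+Te₀;q')}]` over `wilsonMeasure (L := L+1)`,
  `K[·] = ∫ · ∂(ymSpecification ρ β (boxEdges 4 (2H+1)) (torusLift (L+1) U))`.

Plumbing only (Georgii 2011 Thm. 4.17; Friedli–Velenik 2017 Lemma 6.7).  No sorry; standard axioms.  NOT the Yang–Mills mass gap; no item is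
proved here.
-/

set_option autoImplicit false

noncomputable section

open MeasureTheory Filter Topology
open Literature.MathematicalPhysics
open Literature.MathematicalPhysics.QuantumFieldTheory
open Literature.MathematicalPhysics.QuantumLattice
open Literature.Probability.LatticeModels (Torus.proj box mem_box)
open Summit.QuantumFields.YangMills.Theorems.WeakCouplingRates

namespace Summit.QuantumFields.YangMills.Theorems.SixPlaneColdBox

section Torus

variable {N : ℕ} {G : Type} [Group G] [TopologicalSpace G] [IsTopologicalGroup G] [CompactSpace G]
  [MeasurableSpace G] [BorelSpace G]
variable (ρ : G →* Matrix (Fin N) (Fin N) ℂ)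

/-- **The torus plaquette means through the box kernels, every compact `G`, both sites of the transfer.**  For the torus of side
`L+1 > 2(2H+T+2)`, a continuous unitary `ρ` (second-countable `G`) and planes `q, q'`:
`∫ plaqCost0 ρ q (torusLift U) dμ = ∫ (∫ c_{(c_H;q)} ∂K_U) dμ` and `∫ plaqCost0 ρ q' (torusLift U) dμ = ∫ (∫ c_{(c_H+Te₀;q')} ∂K_U) dμ`,
`μ = wilsonMeasure (L := L+1) ρ β`, `K_U = ymSpecification ρ β (boxEdges 4 (2H+1)) (torusLift (L+1) U)` (translation invariance + DLR). -/
theorem torusMean_eq_kernelMean_pairG [SecondCountableTopology G] (hρ : Continuous ρ)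
    (hρu : ∀ g, ρ g ∈ Matrix.unitaryGroup (Fin N) ℂ) (β : ℝ) {H T L : ℕ} (hL : 2 * (2 * H + T + 2) < L + 1)
    (q q' : {q : Fin 4 × Fin 4 // q.1 < q.2}) :
    (∫ U, plaqCost0 ρ q.1.1 q.1.2 (torusLift (L + 1) U) ∂(wilsonMeasure (d := 4) (L := L + 1) ρ β) =
        ∫ U, (∫ W, plaqCostAt ρ (boxCentre H) q.1.1 q.1.2 W
            ∂(ymSpecification (d := 4) ρ β (AxialGauge.boxEdges 4 (2 * H + 1)) (torusLift (L + 1) U)))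
          ∂(wilsonMeasure (d := 4) (L := L + 1) ρ β)) ∧
      (∫ U, plaqCost0 ρ q'.1.1 q'.1.2 (torusLift (L + 1) U) ∂(wilsonMeasure (d := 4) (L := L + 1) ρ β) =
        ∫ U, (∫ W, plaqCostAt ρ (boxCentre H + Pi.single 0 (T : ℤ)) q'.1.1 q'.1.2 W
            ∂(ymSpecification (d := 4) ρ β (AxialGauge.boxEdges 4 (2 * H + 1)) (torusLift (L + 1) U)))
          ∂(wilsonMeasure (d := 4) (L := L + 1) ρ β)) := by
  -- verbatim from the body of `latticeConnectedCorr_pair_eq_boxKernelG` (p1), steps `e2`, `e3`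
  set bc : Literature.Probability.LatticeModels.Site 4 := boxCentre H with hbc
  set v0 : Literature.Probability.LatticeModels.Site 4 := Pi.single 0 (T : ℤ) with hv0
  set Λ : Finset (QuantumLattice.ZdEdge 4) := AxialGauge.boxEdges 4 (2 * H + 1) with hΛ
  set cp : LGConfig 4 G → ℝ := plaqCostAt ρ bc q.1.1 q.1.2 with hcp
  set cp' : LGConfig 4 G → ℝ := plaqCostAt ρ (bc + v0) q'.1.1 q'.1.2 with hcp'
  set S₀ : Finset (QuantumLattice.ZdEdge 4) :=
    plaquetteEdges ((bc, q) : ZdPlaquette 4) ∪ plaquetteEdges ((bc + v0, q') : ZdPlaquette 4) with hS₀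
  have hcyl : IsCylinder cp S₀ := (isCylinder_plaqCostAt_pairG ρ bc q).mono (Finset.coe_subset.2 Finset.subset_union_left)
  have hcyl' : IsCylinder cp' S₀ := (isCylinder_plaqCostAt_pairG ρ (bc + v0) q').mono (Finset.coe_subset.2 Finset.subset_union_right)
  have hinj : Set.InjOn (Torus.proj (L + 1))
      ((Λ ∪ S₀ ∪ (plaquettesTouching Λ).biUnion plaquetteEdges).image Prod.fst :
        Set (Literature.Probability.LatticeModels.Site 4)) := by
    intro x hx y hy hxy
    obtain ⟨e, he, rfl⟩ := Finset.mem_image.1 (Finset.mem_coe.1 hx)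
    obtain ⟨e', he', rfl⟩ := Finset.mem_image.1 (Finset.mem_coe.1 hy)
    exact Literature.Probability.LatticeModels.torusProj_injOn_box hL (fst_mem_box_of_mem_boxUnion_pair q q' he)
      (fst_mem_box_of_mem_boxUnion_pair q q' he') hxy
  have hcpc : Continuous cp := ColdBoxAllGroups.continuous_plaqCostAtG ρ hρ bc q.1.1 q.1.2
  have hcpc' : Continuous cp' := ColdBoxAllGroups.continuous_plaqCostAtG ρ hρ (bc + v0) q'.1.1 q'.1.2
  have hcpK : ∀ U, |cp U| ≤ 2 * N := ColdBoxAllGroups.abs_plaqCostAt_leG ρ hρu bc q.1.1 q.1.2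
  have hcpK' : ∀ U, |cp' U| ≤ 2 * N := ColdBoxAllGroups.abs_plaqCostAt_leG ρ hρu (bc + v0) q'.1.1 q'.1.2
  have dlr : ∀ {F : LGConfig 4 G → ℝ}, Continuous F → ∀ {C : ℝ}, (∀ U, |F U| ≤ C) → IsCylinder F S₀ →
      ∫ U, F (torusLift (L + 1) U) ∂(wilsonMeasure (d := 4) (L := L + 1) ρ β) =
        ∫ U, (∫ W, F W ∂(ymSpecification ρ β Λ (torusLift (L + 1) U))) ∂(wilsonMeasure (d := 4) (L := L + 1) ρ β) := by
    intro F hF C hC hFS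
    have h := wilsonExpectation_toTorusObservable_eq ρ hρ β Λ hF hC hFS (L := L + 1) hinj
    simpa only [wilsonExpectation, toTorusObservable, Function.comp_def] using h
  have hpt1 : ∀ W : LGConfig 4 G, cp (configShift bc W) = plaqCost0 ρ q.1.1 q.1.2 W := fun W => by
    simp only [hcp, plaqCostAt, plaqCost0, plaquetteObs, plaquetteHolonomyZd_configShift, sub_self]
  have hpt3 : ∀ W : LGConfig 4 G, cp' (configShift (bc + v0) W) = plaqCost0 ρ q'.1.1 q'.1.2 W := fun W => by
    simp only [hcp', plaqCostAt, plaqCost0, plaquetteObs, plaquetteHolonomyZd_configShift, sub_self]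
  constructor
  · rw [← dlr hcpc hcpK hcyl, ← integral_comp_configShift_torusLift (S := L + 1) ρ β cp bc]
    simp only [hpt1]
  · rw [← dlr hcpc' hcpK' hcyl', ← integral_comp_configShift_torusLift (S := L + 1) ρ β cp' (bc + v0)]
    simp only [hpt3]

end Torus

end Summit.QuantumFields.YangMills.Theorems.SixPlaneColdBox

end
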